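import Literature.AlgebraicGeometry.Resolution.BlowupFittingIdeal
import Literature.RingTheory.FittingIdeal.LocallyFree
import Literature.RingTheory.FittingIdeal.Localization
import HarnessLib

/-!
# Blowing up a Fitting ideal frees the strict transform (Raynaud–Gruson 5.4.2; Stacks 0810/0811)

Topic: `Literature/AlgebraicGeometry/Resolution`. The punch line of flattening by blowing up a
Fitting ideal, in its local algebraic form (Raynaud–Gruson 1971, Première partie, 5.4.2–5.4.3;
The Stacks Project, Tag 0810 = More on Flatness, Lemma 38.30.2, proof, Steps 8–10, in the basic
case `S = R`, and Tag 0811): let `M` be a finite `R`-module which is "locally free of rank `r`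
away from `V(a)`" in the sense that its Fitting ideals `Fit_k(M)`, `k < r`, are `a`-power
torsion, with `Fit_r(M) = I ∋ a`; let `S` be a local `R`-algebra in which `I S = (a)` with `a`
a nonzerodivisor — every local ring of the chart `R[I/a]` of the blowing up of `Spec R` in `I`
is such (Stacks 07Z3 (1), (2)). Then the local strict transform
`N' = (S ⊗_R M)/(a-power torsion)` is FREE of rank `r`: it is generated by `r` elements
(Stacks 080Z, `BlowupFittingIdeal.lean`), so `Fit_r(N') = S`; and for `k < r`,
`Fit_k(N')` dies after inverting `a` — modulo `a`-power torsion, localising at `a` does not see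
the difference between `N'` and `N = S ⊗_R M`, whose `Fit_k` is `Fit_k(M) S`, `a`-power
torsion — hence `Fit_k(N')`, an ideal of `a`-power torsion elements of `S`, vanishes as `a` is
a nonzerodivisor; now `Fit_{<r} = 0`, `Fit_r = S` over a local ring means free of rank `r`
(Stacks 07ZD, `LocallyFree.lean`).

* `mem_powTorsion_iff` — membership in the `b`-power torsion `⨆ₙ {x ∣ bⁿ x = 0}`;
* `isLocalizedModule_mkQ_powTorsion` — `N → N/(b-power torsion) → (N/(b-power torsion))[1/b]`
  is a localisation of `N` at the powers of `b`;
* `map_fittingIdeal_quotient_powTorsion_eq` — `Fit_k(N/(b-power torsion)) S[1/b] = Fit_k(N) S[1/b]`;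
* `nonempty_basis_quotient_powTorsion_of_fittingIdeal` — over a local ring `S` with `b` a
  nonzerodivisor: `Fit_r(N) = (b)` and `Fit_k(N)` `b`-power torsion for `k < r` imply that
  `N/(b-power torsion)` is free of rank `r`;
* `nonempty_basis_strictTransform_of_fittingIdeal` — **Raynaud–Gruson 5.4.2, local form: the
  local strict transform `(S ⊗_R M)/(a-power torsion)` is free of rank `r`.**

## References

* M. Raynaud, L. Gruson, *Critères de platitude et de projectivité*, Invent. Math. 13 (1971),
  Première partie, 5.4.2, 5.4.3. [RaynaudGruson1971]
* The Stacks Project, Tag 0810 (proof, Steps 8–10), Tag 0811; Tags 080Z, 07ZD, 07ZA, 07Z3.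
  [StacksProject]
-/

namespace Literature.AlgebraicGeometry.Resolution

universe u v

open TensorProduct Literature.RingTheory.FittingIdeal

section PowTorsion

variable {S : Type u} [CommRing S] {N : Type v} [AddCommGroup N] [Module S N] (b : S)

/-- The `b`-power torsion submodules `{x ∣ bⁿ x = 0}` increase with `n`. [folklore] -/
theorem torsionBy_pow_mono : Monotone fun n : ℕ => Submodule.torsionBy S N (b ^ n) := by
  intro n m hnm x hx
  rw [Submodule.mem_torsionBy_iff] at hx ⊢
  obtain ⟨d, rfl⟩ := Nat.exists_eq_add_of_le hnm
  rw [add_comm, pow_add, mul_smul, hx, smul_zero]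

/-- Membership in the `b`-power torsion `⨆ₙ {x ∣ bⁿ x = 0}`. [folklore] -/
theorem mem_powTorsion_iff (x : N) :
    x ∈ (⨆ n : ℕ, Submodule.torsionBy S N (b ^ n)) ↔ ∃ n : ℕ, b ^ n • x = 0 := by
  rw [Submodule.mem_iSup_of_directed _ (torsionBy_pow_mono b).directed_le]
  simp only [Submodule.mem_torsionBy_iff]

/-- **Killing the `b`-power torsion is invisible after inverting `b`**: the composite
`N → N/(b-power torsion) → (N/(b-power torsion))[1/b]` is a localisation of `N` at the powers
of `b`. [folklore] -/
theorem isLocalizedModule_mkQ_powTorsion :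
    IsLocalizedModule (Submonoid.powers b)
      ((LocalizedModule.mkLinearMap (Submonoid.powers b)
        (N ⧸ (⨆ n : ℕ, Submodule.torsionBy S N (b ^ n)))) ∘ₗ
        (⨆ n : ℕ, Submodule.torsionBy S N (b ^ n)).mkQ) := by
  set T : Submodule S N := ⨆ n : ℕ, Submodule.torsionBy S N (b ^ n) with hT
  have hloc : IsLocalizedModule (Submonoid.powers b) (LocalizedModule.mkLinearMap (Submonoid.powers b) (N ⧸ T)) :=
    inferInstance
  refine ⟨hloc.map_units, fun y => ?_, fun {x₁ x₂} h => ?_⟩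
  · obtain ⟨⟨q, s⟩, hq⟩ := hloc.surj y
    obtain ⟨n, rfl⟩ := Submodule.mkQ_surjective T q
    exact ⟨⟨n, s⟩, hq⟩
  · obtain ⟨c, hc⟩ := hloc.exists_of_eq (x₁ := T.mkQ x₁) (x₂ := T.mkQ x₂) h
    simp only [Submonoid.smul_def] at hc
    rw [← map_smul, ← map_smul, ← sub_eq_zero, ← map_sub, ← smul_sub, Submodule.mkQ_apply,
      Submodule.Quotient.mk_eq_zero, mem_powTorsion_iff] at hc
    obtain ⟨n, hn⟩ := hc
    refine ⟨⟨b ^ n * c, Submonoid.mul_mem _ (Submonoid.pow_mem _ (Submonoid.mem_powers b) n) c.2⟩,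
      ?_⟩
    show (b ^ n * ↑c) • x₁ = (b ^ n * ↑c) • x₂
    rw [← sub_eq_zero, ← smul_sub, mul_smul]
    exact hn

/-- **`Fit_k(N/(b-power torsion)) S[1/b] = Fit_k(N) S[1/b]`**: both are the `k`-th Fitting ideal
of the common localisation `(N/(b-power torsion))[1/b] = N[1/b]` (Fitting ideals commute with
localisation, Stacks 07ZA (3)). [cite: StacksProject, Tag 0810 (proof, Step 10)] -/
theorem map_fittingIdeal_quotient_powTorsion_eq [Module.Finite S N] (k : ℕ) :
    (Module.fittingIdeal S (N ⧸ (⨆ n : ℕ, Submodule.torsionBy S N (b ^ n))) k).map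
        (algebraMap S (Localization (Submonoid.powers b))) =
      (Module.fittingIdeal S N k).map (algebraMap S (Localization (Submonoid.powers b))) := by
  haveI := isLocalizedModule_mkQ_powTorsion (N := N) b
  rw [← Module.fittingIdeal_of_isLocalizedModule (Submonoid.powers b)
      (Localization (Submonoid.powers b)) (LocalizedModule.mkLinearMap (Submonoid.powers b)
        (N ⧸ (⨆ n : ℕ, Submodule.torsionBy S N (b ^ n)))) k,
    ← Module.fittingIdeal_of_isLocalizedModule (Submonoid.powers b)
      (Localization (Submonoid.powers b)) ((LocalizedModule.mkLinearMap (Submonoid.powers b)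
        (N ⧸ (⨆ n : ℕ, Submodule.torsionBy S N (b ^ n)))) ∘ₗ
        (⨆ n : ℕ, Submodule.torsionBy S N (b ^ n)).mkQ) k]

/-- **Freeness from Fitting ideals modulo torsion** (Stacks 0810, Steps 8–10, over a local
ring): let `S` be local, `b ∈ S` a nonzerodivisor, `N` a finite `S`-module with
`Fit_r(N) = (b)` and with `Fit_k(N)` consisting of `b`-power torsion elements for `k < r`. Then
`N/(b-power torsion)` is free of rank `r`. [cite: StacksProject, Tag 0810 (proof, Steps 8–10)] -/
theorem nonempty_basis_quotient_powTorsion_of_fittingIdeal [IsLocalRing S] [Module.Finite S N]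
    {r : ℕ} (hb : b ∈ nonZeroDivisors S) (htop : Module.fittingIdeal S N r = Ideal.span {b})
    (htors : ∀ k < r, ∀ x ∈ Module.fittingIdeal S N k, ∃ n : ℕ, b ^ n * x = 0) :
    Nonempty (Module.Basis (Fin r) S (N ⧸ (⨆ n : ℕ, Submodule.torsionBy S N (b ^ n)))) := by
  refine Module.nonempty_basis_of_fittingIdeal ?_ fun k hk => ?_
  · -- generated by `r` elements (Stacks 080Z), hence `Fit_r = S`
    obtain ⟨y, hy⟩ := exists_span_eq_top_quotient_of_le
      (T₂ := ⨆ n : ℕ, Submodule.torsionBy S N (b ^ n))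
      (by conv_lhs => rw [← pow_one b]
          exact le_iSup (fun n : ℕ => Submodule.torsionBy S N (b ^ n)) 1)
      (Module.exists_span_eq_top_quotient_torsionBy htop)
    exact Module.fittingIdeal_eq_top_of_span_eq_top y hy
  · -- `Fit_k` dies in `S[1/b]`, hence is `b`-power torsion, hence zero
    haveI : IsLocalization (Submonoid.powers b) (Localization (Submonoid.powers b)) := inferInstance
    have hN : (Module.fittingIdeal S N k).map (algebraMap S (Localization (Submonoid.powers b))) = ⊥ := by
      rw [Ideal.map_eq_bot_iff_le_ker]
      intro x hx
      obtain ⟨n, hn⟩ := htors k hk x hx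
      rw [RingHom.mem_ker, IsLocalization.map_eq_zero_iff (Submonoid.powers b)]
      exact ⟨⟨b ^ n, n, rfl⟩, hn⟩
    rw [eq_bot_iff]
    intro x hx
    have hx' : algebraMap S (Localization (Submonoid.powers b)) x = 0 := by
      have hmem := Ideal.mem_map_of_mem (algebraMap S (Localization (Submonoid.powers b))) hx
      rw [map_fittingIdeal_quotient_powTorsion_eq, hN] at hmem
      exact (Submodule.mem_bot _).mp hmem
    obtain ⟨⟨_, n, rfl⟩, hn⟩ := (IsLocalization.map_eq_zero_iff (Submonoid.powers b) _ _).mp hx'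
    exact (Submodule.mem_bot S).mpr ((mem_nonZeroDivisors_iff_right.mp (pow_mem hb n)) _
      (by rwa [mul_comm] at hn))

end PowTorsion

/-! ## Raynaud–Gruson 5.4.2: the local strict transform is free of rank `r` -/

variable {R : Type u} [CommRing R] {M : Type u} [AddCommGroup M] [Module R M]

/-- The `a`-power torsion elements of a ring form an ideal containing the image of every ideal
of `a`-power torsion elements. [folklore] -/
theorem exists_pow_mul_eq_zero_of_mem_map {S : Type u} [CommRing S] [Algebra R S] {J : Ideal R}
    {a : R} (hJ : ∀ x ∈ J, ∃ n : ℕ, a ^ n * x = 0) {y : S} (hy : y ∈ J.map (algebraMap R S)) :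
    ∃ n : ℕ, algebraMap R S a ^ n * y = 0 := by
  have key : J.map (algebraMap R S) ≤
      (⨆ n : ℕ, Submodule.torsionBy S S (algebraMap R S a ^ n)).restrictScalars S := by
    rw [Ideal.map_le_iff_le_comap]
    intro x hx
    obtain ⟨n, hn⟩ := hJ x hx
    show algebraMap R S x ∈ ⨆ n : ℕ, Submodule.torsionBy S S (algebraMap R S a ^ n)
    rw [mem_powTorsion_iff]
    exact ⟨n, by rw [smul_eq_mul, ← map_pow, ← map_mul, hn, map_zero]⟩
  have h := key hy
  change y ∈ ⨆ n : ℕ, Submodule.torsionBy S S (algebraMap R S a ^ n) at h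
  rw [mem_powTorsion_iff] at h
  simpa only [smul_eq_mul] using h

/-- **Raynaud–Gruson 1971, 5.4.2 (local form) / Stacks 0810–0811, basic case.** Let `M` be a
finite `R`-module with `Fit_r(M) = I` and whose lower Fitting ideals `Fit_k(M)`, `k < r`, are
`a`-power torsion for some `a ∈ I` (i.e. `M` is locally free of rank `r` away from `V(a)`,
Stacks 07ZD). Let `S` be a local `R`-algebra with `I S = (a)` and `a` a nonzerodivisor in `S` —
e.g. any local ring of the chart `R[I/a]` of the blowing up of `Spec R` in the Fitting ideal
`I` (Stacks 07Z3). Then the local strict transform `(S ⊗_R M)/(a-power torsion)` of `M` is a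
free `S`-module of rank `r`. ("Soit `ℱ` un `𝒪_S`-Module de type fini […] l'éclatement de
l'idéal de Fitting `F_r(ℱ)` rend le transformé strict de `ℱ` localement libre de rang `r`.")
[cite: RaynaudGruson1971, Première partie 5.4.2; StacksProject, Tag 0810] -/
theorem nonempty_basis_strictTransform_of_fittingIdeal [Module.Finite R M] {r : ℕ} {I : Ideal R}
    (hI : Module.fittingIdeal R M r = I) {a : R}
    (htors : ∀ k < r, ∀ x ∈ Module.fittingIdeal R M k, ∃ n : ℕ, a ^ n * x = 0)
    (S : Type u) [CommRing S] [IsLocalRing S] [Algebra R S]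
    (hIS : I.map (algebraMap R S) = Ideal.span {algebraMap R S a})
    (haS : algebraMap R S a ∈ nonZeroDivisors S) :
    Nonempty (Module.Basis (Fin r) S
      ((S ⊗[R] M) ⧸ (⨆ n : ℕ, Submodule.torsionBy S (S ⊗[R] M) (algebraMap R S a ^ n)))) := by
  refine nonempty_basis_quotient_powTorsion_of_fittingIdeal (algebraMap R S a) haS ?_ fun k hk x hx => ?_
  · rw [Module.fittingIdeal_baseChange, hI, hIS]
  · rw [Module.fittingIdeal_baseChange] at hx
    exact exists_pow_mul_eq_zero_of_mem_map (htors k hk) hx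

/-- The same over a local algebra `S` of the affine blowup algebra `R[I/a]` (where `I S = (a)`
automatically, Stacks 07Z3 (2)), assuming `a` is a nonzerodivisor in `S` (as it is in `R[I/a]`,
Stacks 07Z3 (1), and in all its localisations). [cite: RaynaudGruson1971, Première partie 5.4.2] -/
theorem nonempty_basis_strictTransform_blowupAlgebra [Module.Finite R M] {r : ℕ} {I : Ideal R}
    (hI : Module.fittingIdeal R M r = I) {a : R} (ha : a ∈ I)
    (htors : ∀ k < r, ∀ x ∈ Module.fittingIdeal R M k, ∃ n : ℕ, a ^ n * x = 0)
    (S : Type u) [CommRing S] [IsLocalRing S] [Algebra R S] [Algebra (blowupAlgebra I a) S]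
    [IsScalarTower R (blowupAlgebra I a) S] (haS : algebraMap R S a ∈ nonZeroDivisors S) :
    Nonempty (Module.Basis (Fin r) S
      ((S ⊗[R] M) ⧸ (⨆ n : ℕ, Submodule.torsionBy S (S ⊗[R] M) (algebraMap R S a ^ n)))) := by
  refine nonempty_basis_strictTransform_of_fittingIdeal hI htors S ?_ haS
  rw [IsScalarTower.algebraMap_eq R (blowupAlgebra I a) S, ← Ideal.map_map,
    map_blowupAlgebra_eq_span ha, Ideal.map_span, Set.image_singleton]
  rfl

end Literature.AlgebraicGeometry.Resolution
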